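import Summits.Ventures.CertifiedManyBodySolver.Downfold.EmeryBoxesNdNiO2WindowWord
import Summits.Ventures.CertifiedManyBodySolver.Downfold.EmeryBoxesSLCOClassFloorWord
import Summits.Ventures.CertifiedManyBodySolver.Certificates.EmeryCu4O8_kry_SLCO_c0ll_s10x10_F
import Summits.Ventures.CertifiedManyBodySolver.Certificates.EmeryCu4O8_kry_SLCO_c0ll_s10x11_F
import Summits.Ventures.CertifiedManyBodySolver.Certificates.EmeryCu4O8_kry_SLCO_c1hl_s10x10_F
import Summits.Ventures.CertifiedManyBodySolver.Certificates.EmeryCu4O8_kry_SLCO_c1hl_s10x11_F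
import Summits.Ventures.CertifiedManyBodySolver.Certificates.EmeryCu4O8_kry_SLCO_c2lh_s10x10_F
import Summits.Ventures.CertifiedManyBodySolver.Certificates.EmeryCu4O8_kry_SLCO_c2lh_s10x11_F
import HarnessLib

/-!
# TWO-SIDED WINDOW: Sr₀.₉La₀.₁CuO₂ (#37) cGW-SIC CLASS six-box `emeryBoxSLCOClass` at its filling ρ = 51/40 — THE FIRST TWO-SIDED WINDOW ON AN ELECTRON-DOPED 3BE BOX: `245880937/80000000 ≤ e ≤ 43762589/10000000` eV/site at the box's filling ρ = 51/40, and corner CHORD windows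

Venture CertifiedManyBodySolver, cell `pub/hubbard-downfold` (S1 = ROUTER) × crew hubbard-fast S2 (iv); seat hubbard-downfold-mod-4 (S1/S2 Emery seam). Namespace
`Summit.Ventures.CertifiedManyBodySolver.Downfold`. Construction as `EmeryBoxesHg1201P10WindowWord` / `EmeryBoxesHg1201WindowWord`: two unit `Cu₄O₈` cluster vectors of
hubbard-box-p2 g15's KLDL-R series (`kry_SLCO_<c>_s10x10`, N = 20, and `_s10x11`, N = 21; exact rational traces) give affine caps at ρ = 20/16 and 21/16 at every
box point (`rayleighCap_of_traces`), hubbard-box-p1's `EmeryThreeBandFillingConvexity` (`emeryEnergyDensity_le_chord_of_caps`) interpolates to the filling in between,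
and the closed form `affineCapBound` bounds each cap over the six-box (`norm_num [max_def]`).

* per corner pair the BOX CAP: c0ll 4.3762589 / c1hl 4.3782420 / c2lh 4.3779556 eV/site; **`emeryBoxSLCOClass_cuprate_energyWindow`** (floor = the landed word `emeryBoxSLCOClass_cuprate_energyFloor`,
  245880937/80000000 = 3.0735117; cap = the best pair `c0ll`) ;
* the corner floors at any filling (`slcoClassCorner_floor`) and corner CHORD windows (floor = tilted plus certificate at the corner, cap = chord of box-p2's corner caps).

Everything PROVED (0 sorry); no definition. HONEST SCOPE: CERTIFIED inequalities on a typed object of the stated grade (see the box's docstring: SCREENING /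
EXTRAPOLATED); the box cap is the energy's box supremum in max-of-endpoints chord form (point windows carry the two-sided information); energy only — no phase
sentence, no router number moves.
-/

noncomputable section

namespace Summit.Ventures.CertifiedManyBodySolver.Downfold

open NonemptyInterval Matrix Finset Literature.Probability.LatticeModels
open Literature.MathematicalPhysics.QuantumLattice Literature.Computation.Certificates ClusterLowerBound
open Summit.Ventures.CertifiedManyBodySolver.Certificates
open scoped BigOperators ComplexOrder

/-! ## §1 Box caps and THE WINDOW -/

/-- **Box cap from the corner-`c0ll` pair** (N = 20, 21): `e ≤ 43762589/10000000 = 4.3762589` eV/site on the whole box (at the box's filling ρ = 51/40). [cite: Ruelle1969, §3.4] -/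
theorem slcoClass_boxCap_c0ll :
    HoldsOn (fun p : EmeryCoord → ℝ => emeryEnergyDensity (emeryLine cuprateSigns (emeryLineCoords 0 p)) (51/40 : ℝ) ≤ (43762589/10000000 : ℝ)) emeryBoxSLCOClass := by
  have h := holdsOn_emeryEnergyCapAtFixedFilling_of_twoRayleighTraces (E := emeryBoxSLCOClass) (εp := 0) (eA := slcoClassEmery_tpd) (eB := slcoClassEmery_tpp)
    (eD := slcoClassEmery_Delta) (eUd := slcoClassEmery_Udd) (eUp := slcoClassEmery_Upp) rfl rfl rfl rfl rfl cuprateSigns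
    (N₁ := 20) (N₂ := 21) (by norm_num) (by norm_num) (ρ := 51/40) (by norm_num) (by norm_num)
    kry_SLCO_c0ll_s10x10_isNParticle kry_SLCO_c0ll_s10x10_unit_norm (fun a => kry_SLCO_c0ll_s10x10_trace a) kry_SLCO_c0ll_s10x11_isNParticle kry_SLCO_c0ll_s10x11_unit_norm (fun a => kry_SLCO_c0ll_s10x11_trace a)
  have hb : max (affineCapBound cuprateSigns (fun a => (kry_SLCO_c0ll_s10x10_S a : ℝ) / 4294970164 / 16) (emeryLo 0 slcoClassEmery_tpd slcoClassEmery_tpp slcoClassEmery_Delta slcoClassEmery_Udd slcoClassEmery_Upp) (emeryHi 0 slcoClassEmery_tpd slcoClassEmery_tpp slcoClassEmery_Delta slcoClassEmery_Udd slcoClassEmery_Upp))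
      (affineCapBound cuprateSigns (fun a => (kry_SLCO_c0ll_s10x11_S a : ℝ) / 4295005969 / 16) (emeryLo 0 slcoClassEmery_tpd slcoClassEmery_tpp slcoClassEmery_Delta slcoClassEmery_Udd slcoClassEmery_Upp) (emeryHi 0 slcoClassEmery_tpd slcoClassEmery_tpp slcoClassEmery_Delta slcoClassEmery_Udd slcoClassEmery_Upp)) ≤
      (43762589/10000000 : ℝ) := by
    simp only [affineCapBound, emeryLo, emeryHi, lineCoeff, kry_SLCO_c0ll_s10x10_S, kry_SLCO_c0ll_s10x11_S, cuprateSigns, slcoClassEmery_tpd, slcoClassEmery_tpp, slcoClassEmery_Delta, slcoClassEmery_Udd, slcoClassEmery_Upp,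
      Entry.encl_ofEnds_fst, Entry.encl_ofEnds_snd, Fin.sum_univ_succ, Fin.sum_univ_zero,
      Matrix.cons_val_zero, Matrix.cons_val_one, Matrix.cons_val_two, Matrix.cons_val, Matrix.head_cons, Matrix.tail_cons]
    push_cast
    norm_num [max_def]
  intro p hp
  have h' := h p hp
  simp only [Rat.cast_zero] at h'
  exact h'.trans hb

/-- **Box cap from the corner-`c1hl` pair** (N = 20, 21): `e ≤ 2189121/500000 = 4.3782420` eV/site on the whole box (at the box's filling ρ = 51/40). [cite: Ruelle1969, §3.4] -/
theorem slcoClass_boxCap_c1hl :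
    HoldsOn (fun p : EmeryCoord → ℝ => emeryEnergyDensity (emeryLine cuprateSigns (emeryLineCoords 0 p)) (51/40 : ℝ) ≤ (2189121/500000 : ℝ)) emeryBoxSLCOClass := by
  have h := holdsOn_emeryEnergyCapAtFixedFilling_of_twoRayleighTraces (E := emeryBoxSLCOClass) (εp := 0) (eA := slcoClassEmery_tpd) (eB := slcoClassEmery_tpp)
    (eD := slcoClassEmery_Delta) (eUd := slcoClassEmery_Udd) (eUp := slcoClassEmery_Upp) rfl rfl rfl rfl rfl cuprateSigns
    (N₁ := 20) (N₂ := 21) (by norm_num) (by norm_num) (ρ := 51/40) (by norm_num) (by norm_num)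
    kry_SLCO_c1hl_s10x10_isNParticle kry_SLCO_c1hl_s10x10_unit_norm (fun a => kry_SLCO_c1hl_s10x10_trace a) kry_SLCO_c1hl_s10x11_isNParticle kry_SLCO_c1hl_s10x11_unit_norm (fun a => kry_SLCO_c1hl_s10x11_trace a)
  have hb : max (affineCapBound cuprateSigns (fun a => (kry_SLCO_c1hl_s10x10_S a : ℝ) / 4295039302 / 16) (emeryLo 0 slcoClassEmery_tpd slcoClassEmery_tpp slcoClassEmery_Delta slcoClassEmery_Udd slcoClassEmery_Upp) (emeryHi 0 slcoClassEmery_tpd slcoClassEmery_tpp slcoClassEmery_Delta slcoClassEmery_Udd slcoClassEmery_Upp))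
      (affineCapBound cuprateSigns (fun a => (kry_SLCO_c1hl_s10x11_S a : ℝ) / 4295035666 / 16) (emeryLo 0 slcoClassEmery_tpd slcoClassEmery_tpp slcoClassEmery_Delta slcoClassEmery_Udd slcoClassEmery_Upp) (emeryHi 0 slcoClassEmery_tpd slcoClassEmery_tpp slcoClassEmery_Delta slcoClassEmery_Udd slcoClassEmery_Upp)) ≤
      (2189121/500000 : ℝ) := by
    simp only [affineCapBound, emeryLo, emeryHi, lineCoeff, kry_SLCO_c1hl_s10x10_S, kry_SLCO_c1hl_s10x11_S, cuprateSigns, slcoClassEmery_tpd, slcoClassEmery_tpp, slcoClassEmery_Delta, slcoClassEmery_Udd, slcoClassEmery_Upp,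
      Entry.encl_ofEnds_fst, Entry.encl_ofEnds_snd, Fin.sum_univ_succ, Fin.sum_univ_zero,
      Matrix.cons_val_zero, Matrix.cons_val_one, Matrix.cons_val_two, Matrix.cons_val, Matrix.head_cons, Matrix.tail_cons]
    push_cast
    norm_num [max_def]
  intro p hp
  have h' := h p hp
  simp only [Rat.cast_zero] at h'
  exact h'.trans hb

/-- **Box cap from the corner-`c2lh` pair** (N = 20, 21): `e ≤ 10944889/2500000 = 4.3779556` eV/site on the whole box (at the box's filling ρ = 51/40). [cite: Ruelle1969, §3.4] -/
theorem slcoClass_boxCap_c2lh :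
    HoldsOn (fun p : EmeryCoord → ℝ => emeryEnergyDensity (emeryLine cuprateSigns (emeryLineCoords 0 p)) (51/40 : ℝ) ≤ (10944889/2500000 : ℝ)) emeryBoxSLCOClass := by
  have h := holdsOn_emeryEnergyCapAtFixedFilling_of_twoRayleighTraces (E := emeryBoxSLCOClass) (εp := 0) (eA := slcoClassEmery_tpd) (eB := slcoClassEmery_tpp)
    (eD := slcoClassEmery_Delta) (eUd := slcoClassEmery_Udd) (eUp := slcoClassEmery_Upp) rfl rfl rfl rfl rfl cuprateSigns
    (N₁ := 20) (N₂ := 21) (by norm_num) (by norm_num) (ρ := 51/40) (by norm_num) (by norm_num)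
    kry_SLCO_c2lh_s10x10_isNParticle kry_SLCO_c2lh_s10x10_unit_norm (fun a => kry_SLCO_c2lh_s10x10_trace a) kry_SLCO_c2lh_s10x11_isNParticle kry_SLCO_c2lh_s10x11_unit_norm (fun a => kry_SLCO_c2lh_s10x11_trace a)
  have hb : max (affineCapBound cuprateSigns (fun a => (kry_SLCO_c2lh_s10x10_S a : ℝ) / 4294959934 / 16) (emeryLo 0 slcoClassEmery_tpd slcoClassEmery_tpp slcoClassEmery_Delta slcoClassEmery_Udd slcoClassEmery_Upp) (emeryHi 0 slcoClassEmery_tpd slcoClassEmery_tpp slcoClassEmery_Delta slcoClassEmery_Udd slcoClassEmery_Upp))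
      (affineCapBound cuprateSigns (fun a => (kry_SLCO_c2lh_s10x11_S a : ℝ) / 4295018376 / 16) (emeryLo 0 slcoClassEmery_tpd slcoClassEmery_tpp slcoClassEmery_Delta slcoClassEmery_Udd slcoClassEmery_Upp) (emeryHi 0 slcoClassEmery_tpd slcoClassEmery_tpp slcoClassEmery_Delta slcoClassEmery_Udd slcoClassEmery_Upp)) ≤
      (10944889/2500000 : ℝ) := by
    simp only [affineCapBound, emeryLo, emeryHi, lineCoeff, kry_SLCO_c2lh_s10x10_S, kry_SLCO_c2lh_s10x11_S, cuprateSigns, slcoClassEmery_tpd, slcoClassEmery_tpp, slcoClassEmery_Delta, slcoClassEmery_Udd, slcoClassEmery_Upp,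
      Entry.encl_ofEnds_fst, Entry.encl_ofEnds_snd, Fin.sum_univ_succ, Fin.sum_univ_zero,
      Matrix.cons_val_zero, Matrix.cons_val_one, Matrix.cons_val_two, Matrix.cons_val, Matrix.head_cons, Matrix.tail_cons]
    push_cast
    norm_num [max_def]
  intro p hp
  have h' := h p hp
  simp only [Rat.cast_zero] at h'
  exact h'.trans hb

/-- **THE TWO-SIDED WINDOW**: on the whole `emeryBoxSLCOClass`, cuprate signs, at the box's filling ρ = 51/40: `245880937/80000000 ≤ e ≤ 43762589/10000000` eV/site
(`3.0735117 ≤ e ≤ 4.3762589`; floor = the landed word `emeryBoxSLCOClass_cuprate_energyFloor`; cap = the corner-`c0ll` pair). Hypothesis-free.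
[cite: Anderson1951, eq. (2)] [cite: Ruelle1969, §3.4] -/
theorem emeryBoxSLCOClass_cuprate_energyWindow :
    HoldsOn (fun p : EmeryCoord → ℝ =>
      (245880937/80000000 : ℝ) ≤ emeryEnergyDensity (emeryLine cuprateSigns (emeryLineCoords 0 p)) (51/40 : ℝ) ∧
        emeryEnergyDensity (emeryLine cuprateSigns (emeryLineCoords 0 p)) (51/40 : ℝ) ≤ (43762589/10000000 : ℝ)) emeryBoxSLCOClass :=
  holdsOn_window emeryBoxSLCOClass_cuprate_energyFloor slcoClass_boxCap_c0ll

/-! ## §2 Corner windows -/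

/-- **The corner floors at any filling**: for ρ ∈ [0, 3/2], corner `i` carries `q₀ᵢ/8 − μᵢ·ρ ≤ e(emeryLine cuprateSigns (slcoClassCorner i), ρ)`. [cite: Anderson1951, eq. (2)] -/
theorem slcoClassCorner_floor {ρ : ℝ} (hρ0 : 0 ≤ ρ) (hρ1 : ρ ≤ 3 / 2) (i : Fin 4) :
    slcoClassFloor_q0 i / (4 * 2) - slcoClassFloor_mu i * ρ ≤ emeryEnergyDensity (emeryLine cuprateSigns (slcoClassCorner i)) ρ :=
  le_emeryEnergyDensity_of_posSemidef_uniform_levelShift _ (InfVolFermionState.emeryStates_nonempty hρ0 hρ1) emeryCuO4Window two_pos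
    (fun θ => emeryCuO4Window_fit θ) (fun ω' _ => re_expect_zero_cuO4 ω') (slcoClassFloor_mu i) (slcoClassFloor_q0 i) (slcoClassFloor_hq i)

/-- box-p2's corner-`c0ll` vectors sit at the seam's corner `0`. [folklore] -/
theorem kry_SLCO_c0ll_s10x10_theta_eq : kry_SLCO_c0ll_s10x10_theta = emeryLine cuprateSigns (slcoClassCorner 0) ∧ kry_SLCO_c0ll_s10x11_theta = emeryLine cuprateSigns (slcoClassCorner 0) := by
  rw [emeryLine_cuprateSigns]
  constructor <;> (ext a; fin_cases a <;> simp [kry_SLCO_c0ll_s10x10_theta, kry_SLCO_c0ll_s10x11_theta, slcoClassCorner] <;> norm_num)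

/-- **CORNER WINDOW, corner 0 (c0ll), ρ = 51/40**: `2511/800 ≤ e ≤ 34309257/10000000` (`3.1387500 ≤ e ≤ 3.4309257` eV/site; width 0.2922 eV/site = 1.169 eV per formula unit):
floor = the corner's tilted plus certificate, cap = the chord of box-p2's corner caps (3.1452313 at 5/4, 3.8594671 at 21/16). Hypothesis-free.
[cite: Anderson1951, eq. (2)] [cite: Ruelle1969, §3.4] -/
theorem slcoClassCorner0_energyWindow_rho0 :
    (2511/800 : ℝ) ≤ emeryEnergyDensity (emeryLine cuprateSigns (slcoClassCorner 0)) (51/40 : ℝ) ∧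
      emeryEnergyDensity (emeryLine cuprateSigns (slcoClassCorner 0)) (51/40 : ℝ) ≤ (34309257/10000000 : ℝ) := by
  refine ⟨?_, ?_⟩
  · have h := slcoClassCorner_floor (ρ := 51/40) (by norm_num) (by norm_num) 0
    refine le_trans (le_of_eq ?_) h
    simp [slcoClassFloor_q0, slcoClassFloor_mu]
    norm_num
  · have h1 := kry_SLCO_c0ll_s10x10_cap_corner
    have h2 := kry_SLCO_c0ll_s10x11_cap_corner
    rw [kry_SLCO_c0ll_s10x10_theta_eq.1] at h1
    rw [kry_SLCO_c0ll_s10x10_theta_eq.2] at h2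
    have hch := emeryEnergyDensity_le_chord_of_caps (emeryLine cuprateSigns (slcoClassCorner 0)) (ρ₁ := 5/4) (ρ₂ := 21/16) (by norm_num) (by norm_num)
      (by norm_num) h1 h2 (ρ := 51/40) (by norm_num) (by norm_num)
    refine hch.trans ?_
    norm_num

/-- box-p2's corner-`c1hl` vectors sit at the seam's corner `1`. [folklore] -/
theorem kry_SLCO_c1hl_s10x10_theta_eq : kry_SLCO_c1hl_s10x10_theta = emeryLine cuprateSigns (slcoClassCorner 1) ∧ kry_SLCO_c1hl_s10x11_theta = emeryLine cuprateSigns (slcoClassCorner 1) := by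
  rw [emeryLine_cuprateSigns]
  constructor <;> (ext a; fin_cases a <;> simp [kry_SLCO_c1hl_s10x10_theta, kry_SLCO_c1hl_s10x11_theta, slcoClassCorner] <;> norm_num)

/-- **CORNER WINDOW, corner 1 (c1hl), ρ = 51/40**: `61961953/20000000 ≤ e ≤ 1064979/312500` (`3.0980977 ≤ e ≤ 3.4079328` eV/site; width 0.3098 eV/site = 1.239 eV per formula unit):
floor = the corner's tilted plus certificate, cap = the chord of box-p2's corner caps (3.1208031 at 5/4, 3.8386273 at 21/16). Hypothesis-free.
[cite: Anderson1951, eq. (2)] [cite: Ruelle1969, §3.4] -/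
theorem slcoClassCorner1_energyWindow_rho0 :
    (61961953/20000000 : ℝ) ≤ emeryEnergyDensity (emeryLine cuprateSigns (slcoClassCorner 1)) (51/40 : ℝ) ∧
      emeryEnergyDensity (emeryLine cuprateSigns (slcoClassCorner 1)) (51/40 : ℝ) ≤ (1064979/312500 : ℝ) := by
  refine ⟨?_, ?_⟩
  · have h := slcoClassCorner_floor (ρ := 51/40) (by norm_num) (by norm_num) 1
    refine le_trans (le_of_eq ?_) h
    simp [slcoClassFloor_q0, slcoClassFloor_mu]
    norm_num
  · have h1 := kry_SLCO_c1hl_s10x10_cap_corner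
    have h2 := kry_SLCO_c1hl_s10x11_cap_corner
    rw [kry_SLCO_c1hl_s10x10_theta_eq.1] at h1
    rw [kry_SLCO_c1hl_s10x10_theta_eq.2] at h2
    have hch := emeryEnergyDensity_le_chord_of_caps (emeryLine cuprateSigns (slcoClassCorner 1)) (ρ₁ := 5/4) (ρ₂ := 21/16) (by norm_num) (by norm_num)
      (by norm_num) h1 h2 (ρ := 51/40) (by norm_num) (by norm_num)
    refine hch.trans ?_
    norm_num

/-- box-p2's corner-`c2lh` vectors sit at the seam's corner `2`. [folklore] -/
theorem kry_SLCO_c2lh_s10x10_theta_eq : kry_SLCO_c2lh_s10x10_theta = emeryLine cuprateSigns (slcoClassCorner 2) ∧ kry_SLCO_c2lh_s10x11_theta = emeryLine cuprateSigns (slcoClassCorner 2) := by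
  rw [emeryLine_cuprateSigns]
  constructor <;> (ext a; fin_cases a <;> simp [kry_SLCO_c2lh_s10x10_theta, kry_SLCO_c2lh_s10x11_theta, slcoClassCorner] <;> norm_num)

/-- **CORNER WINDOW, corner 2 (c2lh), ρ = 51/40**: `15574707/5000000 ≤ e ≤ 2140153/625000` (`3.1149414 ≤ e ≤ 3.4242448` eV/site; width 0.3093 eV/site = 1.237 eV per formula unit):
floor = the corner's tilted plus certificate, cap = the chord of box-p2's corner caps (3.1383479 at 5/4, 3.8530900 at 21/16). Hypothesis-free.
[cite: Anderson1951, eq. (2)] [cite: Ruelle1969, §3.4] -/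
theorem slcoClassCorner2_energyWindow_rho0 :
    (15574707/5000000 : ℝ) ≤ emeryEnergyDensity (emeryLine cuprateSigns (slcoClassCorner 2)) (51/40 : ℝ) ∧
      emeryEnergyDensity (emeryLine cuprateSigns (slcoClassCorner 2)) (51/40 : ℝ) ≤ (2140153/625000 : ℝ) := by
  refine ⟨?_, ?_⟩
  · have h := slcoClassCorner_floor (ρ := 51/40) (by norm_num) (by norm_num) 2
    refine le_trans (le_of_eq ?_) h
    simp [slcoClassFloor_q0, slcoClassFloor_mu]
    norm_num
  · have h1 := kry_SLCO_c2lh_s10x10_cap_corner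
    have h2 := kry_SLCO_c2lh_s10x11_cap_corner
    rw [kry_SLCO_c2lh_s10x10_theta_eq.1] at h1
    rw [kry_SLCO_c2lh_s10x10_theta_eq.2] at h2
    have hch := emeryEnergyDensity_le_chord_of_caps (emeryLine cuprateSigns (slcoClassCorner 2)) (ρ₁ := 5/4) (ρ₂ := 21/16) (by norm_num) (by norm_num)
      (by norm_num) h1 h2 (ρ := 51/40) (by norm_num) (by norm_num)
    refine hch.trans ?_
    norm_num

end Summit.Ventures.CertifiedManyBodySolver.Downfold

end
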